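import Summits.Ventures.PercRepro.Night2FatXLinesThree
import Summits.Ventures.PercRepro.Night2FatXIndep

/-!
# night-2: the sources of the loads — the rank of the complement and the two off-points of the fat closure

Two structural facts about the lossy big pairs `(B', z')` whose shares `dshGT2` load a target:

* **general** (no fat hypothesis): every coloop face `Q' ∖ c` of a lossy big set `Q' = B' ∪ {z'}` is a thin member
  (`thinFacesOf_eq_image_erase`), so its complement `G ∖ (Q' ∖ c) = (G ∖ Q') ∪ {c}` spans `V`
  (`five_le_rkN_sdiff_of_mem_Uq`): **`four_le_rkN_sdiff_insert_of_loss_ne_zero`**, `rk (G ∖ Q') ≥ 4`.  Hence a loaded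
  target `T` has `rk (G ∖ T) ≥ 3` when its source is at distance one (`T = Q' ∪ {x'}`) and `rk (G ∖ T) ≥ 2` when it is a
  distance-2 target (`three_le_rkN_sdiff_or_d2_of_dload_ne_zero`, `two_le_rkN_sdiff_of_dload_ne_zero`): the two top
  levels of any basis pair (`|G ∖ T| ≤ 1`) are never loaded (`dload_eq_zero_of_card_sdiff_le_one`), and a target with at
  most seven points off `K` — level `2` above a basis — is loaded only if `rk (G ∖ T) ≥ 3`
  (`three_le_rkN_sdiff_of_dload_ne_zero_of_card_le_seven`).
* **fat case** `G ∖ clF B₀ = {w₀, x}`: every thin member misses `w₀` or `x` (`notMem_or_notMem_of_mem_thinMembers`: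
  the complement of a thin member spans `V`, `clF B₀ ∖ K` has rank `4`), so a lossy big set, whose three coloop faces
  are thin members, contains at most one of the two off-points (`notMem_or_notMem_insert_of_loss_ne_zero`).

Paper `proofs/NIGHT-2-g33.md` §1.
-/

namespace PercRepro.Shadow

open PercRepro.ThmH PercRepro.PerFlat

variable {α : Type*} [DecidableEq α] {M : Matroid α} [M.Finite] {G : Finset α}

/-- Inserting a point raises the rank by at most one. -/
theorem rkN_insert_le_succ (X : Finset α) (a : α) : rkN M (insert a X) ≤ rkN M X + 1 := by
  by_cases ha : a ∈ X
  · rw [Finset.insert_eq_of_mem ha]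
    omega
  · have := rkN_erase_ge (M := M) (insert a X) a
    rwa [Finset.erase_insert ha] at this

/-- **Every thin member misses `w₀` or `x`** in the fat case `G ∖ clF B₀ = {w₀, x}`: the complement of a thin member
spans `V` (`five_le_rkN_sdiff_of_mem_Uq`) while `clF B₀ ∖ K` has rank `4`. -/
theorem notMem_or_notMem_of_mem_thinMembers (hG : G ∈ flatsQ M (5 + 1)) (hd : (gr M \ G).card = 2)
    (hk : kColoops M G = 1) {B₀ : Finset α} (hB₀ : B₀ ∈ thinMembers M 5 G) {w₀ x : α}
    (hD : G \ clF M B₀ = {w₀, x}) {F : Finset α} (hF : F ∈ thinMembers M 5 G) : w₀ ∉ F ∨ x ∉ F := by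
  by_contra h
  have hw₀F : w₀ ∈ F := by_contra fun h' => h (Or.inl h')
  have hxF : x ∈ F := by_contra fun h' => h (Or.inr h')
  have hd' : (gr M \ G).card ≤ 5 := by omega
  have hKF : coloops M G ⊆ F := coloops_subset_of_mem_thinMembers hG hd' hF
  have hsub : G \ F ⊆ clF M B₀ \ coloops M G := by
    intro e he
    rw [Finset.mem_sdiff] at he ⊢
    refine ⟨?_, fun hK => he.2 (hKF hK)⟩
    by_contra hcl
    have hmem : e ∈ G \ clF M B₀ := Finset.mem_sdiff.2 ⟨he.1, hcl⟩
    rw [hD, Finset.mem_insert, Finset.mem_singleton] at hmem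
    rcases hmem with rfl | rfl
    · exact he.2 hw₀F
    · exact he.2 hxF
  have h5 := five_le_rkN_sdiff_of_mem_Uq hd (mem_membersIn.1 (mem_thinMembers.1 hF).1).1
  have h4 := rkN_mono (M := M) hsub
  rw [rkN_clF_sdiff_coloops_eq_four_two hG hd hk hB₀] at h4
  omega

/-- The three coloop faces of a lossy big pair are thin members. -/
theorem face_mem_thinMembers_of_loss_ne_zero (hG : G ∈ flatsQ M (5 + 1)) (hd : (gr M \ G).card = 2)
    (hk : kColoops M G = 1) (hs : ∀ e ∈ gr M, ∀ f ∈ gr M, e ≠ f → rkN M {e, f} = 2)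
    (hl : ∀ e ∈ gr M, M.Indep {e}) {B : Finset α} (hB : B ∈ thinMembers M 5 G)
    (hbig : 5 ≤ (B \ coloops M G).card) {z : α} (hz : z ∈ G \ clF M B) (h : loss M 5 G B z ≠ 0)
    {c : α} (hc : c ∈ coloops M (insert z B \ coloops M G)) :
    (insert z B).erase c ∈ thinMembers M 5 G := by
  have hmem : (insert z B).erase c ∈ thinFacesOf M 5 G (insert z B) := by
    rw [thinFacesOf_eq_image_erase hG hd hk hs hl hB hbig hz h, Finset.mem_image]
    exact ⟨c, hc, rfl⟩
  unfold thinFacesOf at hmem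
  rw [Finset.mem_filter] at hmem
  exact mem_thinMembers.2 ⟨(mem_coverPreimages.1 hmem.1).1, hmem.2⟩

/-- **A lossy big pair contains at most one of the two off-points** `w₀, x` of the fat closure: its three coloop
faces are thin members, each missing `w₀` or `x`, so every coloop would be `w₀` or `x`. -/
theorem notMem_or_notMem_insert_of_loss_ne_zero (hG : G ∈ flatsQ M (5 + 1)) (hd : (gr M \ G).card = 2)
    (hk : kColoops M G = 1) (hs : ∀ e ∈ gr M, ∀ f ∈ gr M, e ≠ f → rkN M {e, f} = 2)
    (hl : ∀ e ∈ gr M, M.Indep {e}) {B₀ : Finset α} (hB₀ : B₀ ∈ thinMembers M 5 G) {w₀ x : α}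
    (hD : G \ clF M B₀ = {w₀, x}) {B : Finset α} (hB : B ∈ thinMembers M 5 G)
    (hbig : 5 ≤ (B \ coloops M G).card) {z : α} (hz : z ∈ G \ clF M B) (h : loss M 5 G B z ≠ 0) :
    w₀ ∉ insert z B ∨ x ∉ insert z B := by
  by_contra hboth
  have hw₀Q : w₀ ∈ insert z B := by_contra fun h' => hboth (Or.inl h')
  have hxQ : x ∈ insert z B := by_contra fun h' => hboth (Or.inr h')
  have h3 := card_coloops_eq_three_of_loss_ne_zero hG hd hk hs hl hB hbig hz h
  have hsub : coloops M (insert z B \ coloops M G) ⊆ {w₀, x} := by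
    intro c hc
    have hF := face_mem_thinMembers_of_loss_ne_zero hG hd hk hs hl hB hbig hz h hc
    rw [Finset.mem_insert, Finset.mem_singleton]
    rcases notMem_or_notMem_of_mem_thinMembers hG hd hk hB₀ hD hF with h1 | h1
    · left
      by_contra hne
      exact h1 (Finset.mem_erase.2 ⟨fun h' => hne h'.symm, hw₀Q⟩)
    · right
      by_contra hne
      exact h1 (Finset.mem_erase.2 ⟨fun h' => hne h'.symm, hxQ⟩)
  have h2 : ({w₀, x} : Finset α).card ≤ 2 := Finset.card_le_two
  have := Finset.card_le_card hsub
  omega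

/-- **The complement of a lossy big pair has rank at least `4`** (no fat hypothesis): a coloop face `Q ∖ c` is a
thin member, whose complement `(G ∖ Q) ∪ {c}` spans `V`. -/
theorem four_le_rkN_sdiff_insert_of_loss_ne_zero (hG : G ∈ flatsQ M (5 + 1)) (hd : (gr M \ G).card = 2)
    (hk : kColoops M G = 1) (hs : ∀ e ∈ gr M, ∀ f ∈ gr M, e ≠ f → rkN M {e, f} = 2)
    (hl : ∀ e ∈ gr M, M.Indep {e}) {B : Finset α} (hB : B ∈ thinMembers M 5 G)
    (hbig : 5 ≤ (B \ coloops M G).card) {z : α} (hz : z ∈ G \ clF M B) (h : loss M 5 G B z ≠ 0) :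
    4 ≤ rkN M (G \ insert z B) := by
  have h3 := card_coloops_eq_three_of_loss_ne_zero hG hd hk hs hl hB hbig hz h
  have hne : (coloops M (insert z B \ coloops M G)).Nonempty := by
    rw [← Finset.card_pos]
    omega
  obtain ⟨c, hc⟩ := hne
  have hF := face_mem_thinMembers_of_loss_ne_zero hG hd hk hs hl hB hbig hz h hc
  have h5 := five_le_rkN_sdiff_of_mem_Uq hd (mem_membersIn.1 (mem_thinMembers.1 hF).1).1
  have hcQ : c ∈ insert z B := (Finset.mem_sdiff.1 (mem_coloops.1 hc).1).1
  have hQG : insert z B ⊆ G :=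
    Finset.insert_subset (Finset.mem_sdiff.1 hz).1 (subset_G_of_mem_thinMembers hB)
  have heq : G \ (insert z B).erase c = insert c (G \ insert z B) := by
    ext e
    simp only [Finset.mem_sdiff, Finset.mem_erase, Finset.mem_insert, not_and]
    constructor
    · rintro ⟨heG, h'⟩
      by_cases hec : e = c
      · exact Or.inl hec
      · exact Or.inr ⟨heG, h' hec⟩
    · rintro (rfl | ⟨heG, heQ⟩)
      · exact ⟨hQG hcQ, fun h' => (h' rfl).elim⟩
      · exact ⟨heG, fun _ => heQ⟩
  rw [heq] at h5
  have := rkN_insert_le_succ (M := M) (G \ insert z B) c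
  omega

/-- **A loaded target has a complement of rank at least `3`, or it is a distance-2 target of a lossy big pair
without good points and its complement has rank at least `2`.** -/
theorem three_le_rkN_sdiff_or_d2_of_dload_ne_zero (hG : G ∈ flatsQ M (5 + 1)) (hd : (gr M \ G).card = 2)
    (hk : kColoops M G = 1) (hs : ∀ e ∈ gr M, ∀ f ∈ gr M, e ≠ f → rkN M {e, f} = 2)
    (hl : ∀ e ∈ gr M, M.Indep {e}) (hfat : (fatClosures M 5 G 2).card ≤ 1) {T : Finset α}
    (hne : dload M 5 G (bigP M G) (dshGT2 M 5 G) T ≠ 0) :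
    3 ≤ rkN M (G \ T) ∨
      (2 ≤ rkN M (G \ T) ∧ ∃ B ∈ thinMembers M 5 G, 5 ≤ (B \ coloops M G).card ∧
        ∃ z ∈ G \ clF M B, loss M 5 G B z ≠ 0 ∧ ¬ (gtPts M 5 G (insert z B)).Nonempty ∧
          ∃ p ∈ d2Pts M 5 G (insert z B), T = insert p.1 (insert p.2 (insert z B))) := by
  obtain ⟨B, hB, hbig, z, hz, hloss, hcase⟩ := exists_pair_of_dload_ne_zero' hG hd hk hs hl hfat hne
  have h4 := four_le_rkN_sdiff_insert_of_loss_ne_zero hG hd hk hs hl hB hbig hz hloss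
  rcases hcase with ⟨-, x, hx, rfl⟩ | ⟨hno, p, hp, rfl⟩
  · left
    obtain ⟨hxG, hxQ⟩ := Finset.mem_sdiff.1 (mem_goodPts.1 hx).1
    rw [Finset.mem_insert, not_or] at hxQ
    have heq : G \ insert z B = insert x (G \ insert x (insert z B)) := by
      ext e
      simp only [Finset.mem_sdiff, Finset.mem_insert, not_or]
      constructor
      · rintro ⟨heG, heQ⟩
        by_cases hex : e = x
        · exact Or.inl hex
        · exact Or.inr ⟨heG, hex, heQ⟩
      · rintro (rfl | ⟨heG, -, heQ⟩)
        · exact ⟨hxG, hxQ⟩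
        · exact ⟨heG, heQ⟩
    rw [heq] at h4
    have := rkN_insert_le_succ (M := M) (G \ insert x (insert z B)) x
    omega
  · right
    obtain ⟨⟨hp1, hp2⟩, -, -⟩ := mem_d2Pts.1 hp
    obtain ⟨hp1G, hp1'⟩ := Finset.mem_sdiff.1 hp1
    obtain ⟨hp2G, hp2'⟩ := Finset.mem_sdiff.1 hp2
    rw [Finset.mem_insert, not_or] at hp1' hp2'
    refine ⟨?_, B, hB, hbig, z, hz, hloss, hno, p, hp, rfl⟩
    have heq : G \ insert z B = insert p.1 (insert p.2 (G \ insert p.1 (insert p.2 (insert z B)))) := by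
      ext e
      simp only [Finset.mem_sdiff, Finset.mem_insert, not_or]
      constructor
      · rintro ⟨heG, heQ⟩
        by_cases he1 : e = p.1
        · exact Or.inl he1
        · by_cases he2 : e = p.2
          · exact Or.inr (Or.inl he2)
          · exact Or.inr (Or.inr ⟨heG, he1, he2, heQ⟩)
      · rintro (rfl | rfl | ⟨heG, -, -, heQ⟩)
        · exact ⟨hp1G, hp1'⟩
        · exact ⟨hp2G, hp2'⟩
        · exact ⟨heG, heQ⟩
    rw [heq] at h4
    have h1 := rkN_insert_le_succ (M := M) (insert p.2 (G \ insert p.1 (insert p.2 (insert z B)))) p.1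
    have h2 := rkN_insert_le_succ (M := M) (G \ insert p.1 (insert p.2 (insert z B))) p.2
    omega

/-- **A loaded target has a complement of rank at least `2`.** -/
theorem two_le_rkN_sdiff_of_dload_ne_zero (hG : G ∈ flatsQ M (5 + 1)) (hd : (gr M \ G).card = 2)
    (hk : kColoops M G = 1) (hs : ∀ e ∈ gr M, ∀ f ∈ gr M, e ≠ f → rkN M {e, f} = 2)
    (hl : ∀ e ∈ gr M, M.Indep {e}) (hfat : (fatClosures M 5 G 2).card ≤ 1) {T : Finset α}
    (hne : dload M 5 G (bigP M G) (dshGT2 M 5 G) T ≠ 0) : 2 ≤ rkN M (G \ T) := by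
  rcases three_le_rkN_sdiff_or_d2_of_dload_ne_zero hG hd hk hs hl hfat hne with h | ⟨h, -⟩
  · omega
  · exact h

/-- **The two top levels are never loaded**: a target missing at most one point of `G` carries no `dshGT2` load. -/
theorem dload_eq_zero_of_card_sdiff_le_one (hG : G ∈ flatsQ M (5 + 1)) (hd : (gr M \ G).card = 2)
    (hk : kColoops M G = 1) (hs : ∀ e ∈ gr M, ∀ f ∈ gr M, e ≠ f → rkN M {e, f} = 2)
    (hl : ∀ e ∈ gr M, M.Indep {e}) (hfat : (fatClosures M 5 G 2).card ≤ 1) {T : Finset α}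
    (hT : (G \ T).card ≤ 1) : dload M 5 G (bigP M G) (dshGT2 M 5 G) T = 0 := by
  by_contra hne
  have h2 := two_le_rkN_sdiff_of_dload_ne_zero hG hd hk hs hl hfat hne
  have := rkN_le_card (M := M) (G \ T)
  omega

/-- **A loaded target with at most seven points off `K` has a complement of rank at least `3`**: its source is at
distance one (a distance-2 target has at least eight points off `K`). -/
theorem three_le_rkN_sdiff_of_dload_ne_zero_of_card_le_seven (hG : G ∈ flatsQ M (5 + 1))
    (hd : (gr M \ G).card = 2) (hk : kColoops M G = 1)
    (hs : ∀ e ∈ gr M, ∀ f ∈ gr M, e ≠ f → rkN M {e, f} = 2) (hl : ∀ e ∈ gr M, M.Indep {e})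
    (hfat : (fatClosures M 5 G 2).card ≤ 1) {T : Finset α} (hT7 : (T \ coloops M G).card ≤ 7)
    (hne : dload M 5 G (bigP M G) (dshGT2 M 5 G) T ≠ 0) : 3 ≤ rkN M (G \ T) := by
  rcases three_le_rkN_sdiff_or_d2_of_dload_ne_zero hG hd hk hs hl hfat hne with h | ⟨-, B, hB, hbig, z, hz, -, -, p, hp, rfl⟩
  · exact h
  · exfalso
    have hd' : (gr M \ G).card ≤ 5 := by omega
    have hKB : coloops M G ⊆ B := coloops_subset_of_mem_thinMembers hG hd' hB
    have hzB : z ∉ B := fun h' => (Finset.mem_sdiff.1 hz).2 (subset_clF_of_subset_gr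
      ((subset_G_of_mem_thinMembers hB).trans (mem_flatsQ.1 hG).1) h')
    have hzK : z ∉ coloops M G := fun h' => hzB (hKB h')
    obtain ⟨⟨hp1, hp2⟩, hp12, -⟩ := mem_d2Pts.1 hp
    have hp1Q : p.1 ∉ insert z B := (Finset.mem_sdiff.1 hp1).2
    have hp2Q : p.2 ∉ insert z B := (Finset.mem_sdiff.1 hp2).2
    have hp1K : p.1 ∉ coloops M G := fun h' => hp1Q (Finset.mem_insert_of_mem (hKB h'))
    have hp2K : p.2 ∉ coloops M G := fun h' => hp2Q (Finset.mem_insert_of_mem (hKB h'))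
    have h1 : insert z B \ coloops M G = insert z (B \ coloops M G) := by
      ext e
      simp only [Finset.mem_sdiff, Finset.mem_insert]
      constructor
      · rintro ⟨h | h, h2⟩
        · exact Or.inl h
        · exact Or.inr ⟨h, h2⟩
      · rintro (rfl | ⟨h, h2⟩)
        · exact ⟨Or.inl rfl, hzK⟩
        · exact ⟨Or.inr h, h2⟩
    have h2 : insert p.1 (insert p.2 (insert z B)) \ coloops M G =
        insert p.1 (insert p.2 (insert z B \ coloops M G)) := by
      ext e
      simp only [Finset.mem_sdiff, Finset.mem_insert]
      constructor
      · rintro ⟨h | h | h, h2⟩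
        · exact Or.inl h
        · exact Or.inr (Or.inl h)
        · exact Or.inr (Or.inr ⟨h, h2⟩)
      · rintro (rfl | rfl | ⟨h, h2⟩)
        · exact ⟨Or.inl rfl, hp1K⟩
        · exact ⟨Or.inr (Or.inl rfl), hp2K⟩
        · exact ⟨Or.inr (Or.inr h), h2⟩
    rw [h2, Finset.card_insert_of_notMem, Finset.card_insert_of_notMem
      (fun h' => hp2Q (Finset.mem_sdiff.1 h').1), h1,
      Finset.card_insert_of_notMem (fun h' => hzB (Finset.mem_sdiff.1 h').1)] at hT7
    · omega
    · rw [Finset.mem_insert, Finset.mem_sdiff]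
      rintro (h' | ⟨h', -⟩)
      · exact hp12 h'
      · exact hp1Q h'

end PercRepro.Shadow
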